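import Summits.CriticalPhenomena.PercolationContinuityZ3.Theorems.PercNearOneGluingNoHeavyLowerTailSahiSlotPinnedCharge
import Summits.CriticalPhenomena.PercolationContinuityZ3.Theorems.PercNearOneGluingNoHeavyLowerTailSahiSlotPatternThree
import Summits.CriticalPhenomena.PercolationContinuityZ3.Theorems.PercNearOneGluingNoHeavyLowerTailSahiLatinDictionary

/-!
# The slot-pattern kernel with a pinned slot, IV: at ORDER 3 the pinned kernel IS prim-master-conj's charge `Φ_bc(m)` (dictionary)

Support file of the one-cut programme (crux `NoHeavyLowerTail`, stmt-CriticalPhenomena-4575; cell `prim-masterthm`, seat P3, gen 29; `HIERARCHY.md` §36).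
The all-order theorems of `…SahiSlotPinnedCharge` (`pinned_eq_topCell`, `pinned_nonneg_of_mem`, `pinned_mono_of_mem`) concern
`patternForm d (N+2) (𝟙_{m}, 𝟙_{a_0},…,𝟙_{a_N})`.  At `N = 1` (order 3) this number is LITERALLY prim-master-conj's order-3 charge (`…SahiLatinKernel`,
`SahiLatin.Phi b c m`, the coefficient of `[m ∈ a]` in the Latin kernel `κ(a,b,c)`), for the index type `ι = Fin d`:
* **`pinned_three_eq_cast_Phi`**: `patternForm d 3 (𝟙_{m}, 𝟙_{a 0}, 𝟙_{a 1}) = Φ_{a 0, a 1}(m)` — through P3 gen 18's `patternForm_three_setInd` (`= sStarD`),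
  master-conj gen 42's `SahiLatin.kappa_eq_sStarD` and the first-point form `SahiLatin.kappa_eq_sum_Phi`;
* hence the order-3 cases of the all-order theorems in the `SahiLatin` vocabulary on `Fin d → Fin 3` (`Phi_mono_of_mem_inter_fin`, re-deriving the `ι = Fin d`
  case of master-conj's `Phi_mono_of_mem_inter`; a consistency anchor, not a new fact).
No definitions; everything proved; axioms standard. [this work]
-/

noncomputable section

namespace Summit.CriticalPhenomena.PercolationContinuityZ3.Theorems

open Finset Function Equiv Equiv.Perm
open Literature.Combinatorics.Sahi2008 Literature.Combinatorics.Sahi2008.CycleForm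

namespace SahiSlot

variable {d : ℕ}

/-- **ORDER-3 DICTIONARY**: the pinned slot-pattern kernel at order 3 is prim-master-conj's charge `Φ_{bc}(m)` (index type `Fin d`). [this work] -/
theorem pinned_three_eq_cast_Phi (a : Fin 2 → Finset (Q d 3)) (m : Q d 3) :
    patternForm d 3 (Fin.cons (setInd {m}) (fun i => setInd (a i)) : Fin 3 → Q d 3 → ℝ) = (SahiLatin.Phi (a 0) (a 1) m : ℝ) := by
  have hcons : (Fin.cons (setInd {m}) (fun i => setInd (a i)) : Fin 3 → Q d 3 → ℝ) =
      fun i => setInd ((Fin.cons {m} a : Fin 3 → Finset (Q d 3)) i) := by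
    funext i
    refine Fin.cases ?_ (fun j => ?_) i <;> rfl
  have h0 : (Fin.cons {m} a : Fin 3 → Finset (Q d 3)) 0 = {m} := rfl
  have h1 : (Fin.cons {m} a : Fin 3 → Finset (Q d 3)) 1 = a 0 := rfl
  have h2 : (Fin.cons {m} a : Fin 3 → Finset (Q d 3)) 2 = a 1 := rfl
  rw [hcons, patternForm_three_setInd, h0, h1, h2, ← SahiLatin.kappa_eq_sStarD, SahiLatin.kappa_eq_sum_Phi, sum_singleton]

/-- Order 3 of `pinned_mono_of_mem` in the `SahiLatin` vocabulary: for up-sets `b, c ⊆ [3]^d`, `Φ_{bc}` is order-preserving on `b ∩ c`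
(the `ι = Fin d` case of prim-master-conj's `SahiLatin.Phi_mono_of_mem_inter`, re-derived from the all-order theorem). [this work] -/
theorem Phi_mono_of_mem_inter_fin {b c : Finset (Q d 3)} (hb : IsUpperSet ((b : Finset (Q d 3)) : Set (Q d 3)))
    (hc : IsUpperSet ((c : Finset (Q d 3)) : Set (Q d 3))) {u v : Q d 3} (huv : u ≤ v) (hub : u ∈ b) (huc : u ∈ c) :
    SahiLatin.Phi b c u ≤ SahiLatin.Phi b c v := by
  have ha : ∀ i : Fin 2, IsUpperSet (((![b, c] : Fin 2 → Finset (Q d 3)) i : Finset (Q d 3)) : Set (Q d 3)) := by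
    intro i
    fin_cases i
    · exact hb
    · exact hc
  have hu : ∀ i : Fin 2, u ∈ (![b, c] : Fin 2 → Finset (Q d 3)) i := by
    intro i
    fin_cases i
    · exact hub
    · exact huc
  have h := pinned_mono_of_mem (![b, c]) ha huv hu
  rw [pinned_three_eq_cast_Phi, pinned_three_eq_cast_Phi] at h
  exact_mod_cast h

/-- Order 3 of `pinned_nonneg_of_mem` in the `SahiLatin` vocabulary: `Φ_{bc}(u) ≥ 0` for `u ∈ b ∩ c`, arbitrary finite `b, c ⊆ [3]^d`
(the `ι = Fin d` case of prim-master-conj's `SahiLatin.Phi_nonneg_of_mem`, re-derived). [this work] -/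
theorem Phi_nonneg_of_mem_fin (b c : Finset (Q d 3)) {u : Q d 3} (hub : u ∈ b) (huc : u ∈ c) : 0 ≤ SahiLatin.Phi b c u := by
  have hu : ∀ i : Fin 2, u ∈ (![b, c] : Fin 2 → Finset (Q d 3)) i := by
    intro i
    fin_cases i
    · exact hub
    · exact huc
  have h := pinned_nonneg_of_mem (![b, c]) hu
  rw [pinned_three_eq_cast_Phi] at h
  exact_mod_cast h

end SahiSlot

end Summit.CriticalPhenomena.PercolationContinuityZ3.Theorems
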